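import Summits.AnomalousDissipation.AnomalousDissipation.Theorems.CoherentFractionInvariantExtremeClimatesPlanar.Negative.OrbitExtreme
import HarnessLib

/-!
# Scope of the orbit-climate witness: which drifts are dead
# (negative lane of `CoherentFraction.InvariantExtremeClimatesPlanar`, stmt-AnomalousDissipation-28074)

The refutation `CoherentFractionInvariantExtremeClimatesPlanar_refuted` instantiates the item's
drift at `m = c_K e₁`.  This file records that the SAME witness bites every drift whose vertical
component is `c_K`: the invariant-climate class `C̄(m, R)` quantifies over all horizontal Galilean
drifts `m + h`, `h ⊥ e₁`, so it only depends on `m` through `⟪m, e₁⟫`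
(`climateClass_add_of_inner_eq_zero`, a reindexing `h ↦ h₀ + h` of the defining family), and hence
the orbit climate is an extreme point of `C̄(m, R₀)` — of infinite Fourier type and with non-planar
support — for every `m` with `⟪m, e₁⟫ = c_K` (`orbMeasure_mem_extremePoints_of_inner_eq`).
Consequently a repair of the item that keeps any drift `m ∈ c_K e₁ + e₁^⊥` is refuted by the same
four lane files; only the vertical component of the drift matters. [folklore]
-/

noncomputable section

set_option linter.dupNamespace false

namespace Summit.AnomalousDissipation.AnomalousDissipation.Theorems.CrossedShearOrbit

open Real MeasureTheory Filter Topology Set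
open scoped InnerProductSpace ENNReal
open Literature.Analysis.FunctionSpaces Literature.Analysis.FunctionSpaces.Torus Literature.Analysis.FluidPDE
open Literature.Analysis.FluidPDE.Torus
open Summit.AnomalousDissipation.AnomalousDissipation.Theorems.CrossedShearRoot

local notation "E³" => EuclideanSpace ℝ (Fin 3)
local notation "H" => energySpace (Fin 3)

/-- Shifting the drift by `h₀` is the same as shifting the Galilean parameter: `N_{(m+h₀)+h} = N_{m+(h₀+h)}`.
[folklore] -/
theorem routeIntegrand_add (m h₀ h : E³) (Φ : CylindricalTest (Fin 3)) (u : H) :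
    routeIntegrand (m + h₀) h Φ u = routeIntegrand m (h₀ + h) Φ u := by
  simp only [routeIntegrand, add_assoc]

/-- **Horizontal drifts reindex the class**: `C̄(m + h₀, R) = C̄(m, R)` for every horizontal `h₀ ⊥ e₁`,
because the defining family `∀ h ⊥ e₁, ∫ N_{m+h} = 0` is reindexed by `h ↦ h₀ + h`. [folklore] -/
theorem climateClass_add_of_inner_eq_zero (m : E³) {h₀ : E³} (R : ℝ)
    (hh₀ : ⟪h₀, EuclideanSpace.single (1 : Fin 3) (1 : ℝ)⟫_ℝ = 0) :
    climateClass (m + h₀) R = climateClass m R := by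
  ext ρ
  simp only [climateClass, Set.mem_setOf_eq]
  refine and_congr_right fun _ => and_congr_right fun _ => ⟨fun hs h hh Φ => ?_, fun hs h hh Φ => ?_⟩
  · have key := hs (h - h₀) (by rw [inner_sub_left, hh, hh₀, sub_zero]) Φ
    simpa only [routeIntegrand_add, add_sub_cancel] using key
  · have key := hs (h₀ + h) (by rw [inner_add_left, hh, hh₀, add_zero]) Φ
    simpa only [routeIntegrand_add] using key

/-- The class only sees the vertical component of the drift: `⟪m, e₁⟫ = ⟪m', e₁⟫ → C̄(m, R) = C̄(m', R)`.
[folklore] -/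
theorem climateClass_eq_of_inner_eq {m m' : E³} (R : ℝ)
    (h : ⟪m, EuclideanSpace.single (1 : Fin 3) (1 : ℝ)⟫_ℝ = ⟪m', EuclideanSpace.single (1 : Fin 3) (1 : ℝ)⟫_ℝ) :
    climateClass m R = climateClass m' R := by
  have h0 : ⟪m - m', EuclideanSpace.single (1 : Fin 3) (1 : ℝ)⟫_ℝ = 0 := by
    rw [inner_sub_left, h, sub_self]
  simpa only [add_sub_cancel] using climateClass_add_of_inner_eq_zero m' R h0

/-- `⟪c_K e₁, e₁⟫ = c_K`. [folklore] -/
theorem inner_drift_single_one : ⟪drift, EuclideanSpace.single (1 : Fin 3) (1 : ℝ)⟫_ℝ = cK := by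
  simp [drift, EuclideanSpace.inner_single_right]

/-- **Every drift with vertical component `c_K` is dead (membership).** [folklore] -/
theorem orbMeasure_mem_climateClass_of_inner_eq {m : E³}
    (hm : ⟪m, EuclideanSpace.single (1 : Fin 3) (1 : ℝ)⟫_ℝ = cK) :
    orbMeasure ∈ climateClass m R0 := by
  rw [climateClass_eq_of_inner_eq R0 (hm.trans inner_drift_single_one.symm)]
  exact orbMeasure_mem_climateClass

/-- **Every drift with vertical component `c_K` is dead (extremality)**: for every `m` with
`⟪m, e₁⟫ = c_K` the orbit climate is an extreme point of `C̄(m, R₀)`; together with `not_finiteType`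
and `not_ae_defect_zero` this refutes the item's conclusion on the whole affine hyperplane
`c_K e₁ + e₁^⊥` of drifts. [folklore] -/
theorem orbMeasure_mem_extremePoints_of_inner_eq {m : E³}
    (hm : ⟪m, EuclideanSpace.single (1 : Fin 3) (1 : ℝ)⟫_ℝ = cK) :
    orbMeasure ∈ (climateClass m R0).extremePoints ℝ≥0∞ := by
  rw [climateClass_eq_of_inner_eq R0 (hm.trans inner_drift_single_one.symm)]
  exact orbMeasure_mem_extremePoints

end Summit.AnomalousDissipation.AnomalousDissipation.Theorems.CrossedShearOrbit

end
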